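import Literature.Topology.FourManifolds.HCobordismCancellationFrameSmooth
import Literature.Topology.FourManifolds.HCobordismLocalIsotopy
import Literature.Topology.FourManifolds.MorseChartChangeInterior
import Literature.Topology.FourManifolds.InteriorFieldFlow
import HarnessLib

/-!
# Milnor 1965, proof of Thm. 5.4, Assertion 6, the general case: the transverse intersection of
# `S_R(b₂)` and `S_L'(b₂)` at `p₂` makes the block `A` of `D(h₀⁻¹h)(p₁)` invertible

Topic `Literature/Topology/FourManifolds` (fact seat
`provefact-Literature.Topology.FourManifolds.Cobord-8b1ec36bf6`, tenure on
`Literature.Topology.FourManifolds.Cobordism.Milnor1965_cancellation_modelChart`; sequel of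
`HCobordismCancellationFrameSmooth.lean`).  Everything here is **proved**; no named facts.

Milnor, *Lectures on the h-cobordism theorem* (1965), PDF pp. 31–33.  Hypothesis 2) of
Thm. 5.6 for `h₀⁻¹h` asks that `h₀⁻¹h(Rᵃ)` meet `Rᵇ` transversally at `0`, i.e. (proof of
Lemma 5.7, PDF p. 33) that the block `A` of the matrix `D(h₀⁻¹h)(0) = (A *; * *)` be
non-singular; its sign is then adjusted by the *"preliminary alteration of `g₂`"*.  In the
frame this transversality is inherited from the hypothesis of Thm. 5.4 — *"`S_R ∩ S_L'` is a
single point with transverse intersection"* in the level `b` — transported to the level `b₂`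
along `ξ` (`Literature.Topology.FourManifolds.Cobordism.IsMorseFunction.isTransverseInLevel_of_level`)
and read in the level coordinates at `p₂`: in Milnor's straightening chart `φ` at `p₂`
(`Literature.Topology.FourManifolds.IsTransverseInLevel`) `S_R(b₂)` and `S_L'(b₂)` are
complementary coordinate planes of the level, while in the coordinates `ψ₂` the image
`h(Rᵃ) ⊆ S_R(b₂)` is parametrised by `u ↦ Hc(u, 0)` and `S_L'(b₂)` is the plane `Rᵇ`;
differentiating the two "coordinates are constant" relations and using the left inverses of
`Hc`, `Λcinv`, `Φ` and of the chart map shows that `u ↦ pr_a D(Φ)(0)(u, 0)`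
(`Literature.Topology.FourManifolds.fstBlock`) is injective, hence invertible.

## Contents (all proved)

* `CancellationFrame.isTransverseInLevel_p₂` — transversality at `p₂` in the level `b₂` from
  the hypothesis at `x₀` in the level `b`;
* `CancellationFrame.fderiv_Φinv_comp_fderiv_Φ` (and the `Hc`, `Λcinv` analogues) — the
  derivatives at `0` have left inverses (from the local inverses), so `det D(Φ)(0) ≠ 0`
  (`det_fderiv_Φ_ne_zero`);
* `CancellationFrame.fst_fderiv_Λcinv` — `D(Λcinv)(0)` is block-diagonal (`h'⁻¹` preserves both
  coordinate planes);
* `CancellationFrame.injective_fstBlock_fderiv_Φ`, `det_fstBlock_fderiv_Φ_ne_zero` — **the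
  block `A` of `D(h₀⁻¹h)(0)` is invertible**.

## References

* J. Milnor, *Lectures on the h-cobordism theorem*, notes by L. Siebenmann and J. Sondow,
  Princeton Mathematical Notes (1965): Def. 5.1 and PDF p. 27; proof of Thm. 5.4, Assertion 6
  (PDF pp. 31–32); Thm. 5.6 and proof of Lemma 5.7 (PDF pp. 32–33).  Held:
  `lit read book:milnornd-lectures-h-cobordism-theorem`. [MilnorHCobordism1965]
-/

open scoped Manifold ContDiff Topology NNReal
open Set Function Filter

noncomputable section

namespace Literature.Topology.FourManifolds

open Flow

universe u

/-- Local notation: `𝔼 n` is the model Euclidean space `EuclideanSpace ℝ (Fin n)`. -/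
local notation "𝔼 " n:arg => EuclideanSpace ℝ (Fin n)

variable {n : ℕ} {M N : Type u} [TopologicalSpace M] [ChartedSpace (𝔼 n) M]
  [TopologicalSpace N] [ChartedSpace (𝔼 n) N]

/-! ### A calculus lemma -/

section Calculus

variable {E F : Type*} [NormedAddCommGroup E] [NormedSpace ℝ E] [NormedAddCommGroup F]
  [NormedSpace ℝ F]

/-- **A local left inverse gives a left inverse of the derivative**: if `g ∘ φ = id` near `x`
and both are differentiable (at `x`, `φ x`) then `Dg(φ x) ∘ Dφ(x) = id`. [folklore] -/
theorem fderiv_comp_fderiv_eq_id_of_eventuallyEq {φ : E → F} {g : F → E} {x : E}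
    (hφ : DifferentiableAt ℝ φ x) (hg : DifferentiableAt ℝ g (φ x))
    (h : ∀ᶠ y in 𝓝 x, g (φ y) = y) :
    (fderiv ℝ g (φ x)).comp (fderiv ℝ φ x) = ContinuousLinearMap.id ℝ E := by
  have h1 : HasFDerivAt (g ∘ φ) ((fderiv ℝ g (φ x)).comp (fderiv ℝ φ x)) x :=
    hg.hasFDerivAt.comp x hφ.hasFDerivAt
  have h2 : HasFDerivAt (g ∘ φ) (ContinuousLinearMap.id ℝ E) x :=
    (hasFDerivAt_id x).congr_of_eventuallyEq (h.mono fun y hy => hy)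
  exact h1.unique h2

end Calculus

namespace Cobordism

namespace CancellationFrame

variable {c : Cobordism n M N} {f : c.W → ℝ}
  {ξ : Cₛ^∞⟮𝓡∂ (n + 1); 𝔼 (n + 1), (TangentSpace (𝓡∂ (n + 1)) : c.W → Type)⟯}
  {p p' : c.W} {k : ℕ} {v : ℝ → ℝ} {b₁ b₂ : ℝ}
  (D : CancellationFrame c f ξ p p' k v b₁ b₂)

/-! ### Transversality at `p₂` -/

/-- **`S_R(b₂)` and `S_L'(b₂)` meet transversally at `p₂`**, from the hypothesis of Thm. 5.4 in
the level `b` (transport along `ξ`). [cite: MilnorHCobordism1965, Thm. 5.4 and its proof (PDF pp. 27, 30–31)] -/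
theorem isTransverseInLevel_p₂ {x₀ : c.W} {b : ℝ}
    (hx₀ : rightHandSphere (𝓡∂ (n + 1)) f ξ p b ∩ leftHandSphere (𝓡∂ (n + 1)) f ξ p' b = {x₀})
    (hT : IsTransverseInLevel (𝓡∂ (n + 1)) (f ⁻¹' {b}) (rightHandSphere (𝓡∂ (n + 1)) f ξ p b)
      (leftHandSphere (𝓡∂ (n + 1)) f ξ p' b) x₀)
    (hpb : f p < b) (hbp' : b < f p') :
    IsTransverseInLevel (𝓡∂ (n + 1)) (f ⁻¹' {b₂}) (rightHandSphere (𝓡∂ (n + 1)) f ξ p b₂)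
      (leftHandSphere (𝓡∂ (n + 1)) f ξ p' b₂) D.p₂ :=
  D.isMorseFunction.isTransverseInLevel_of_level ξ D.isGradientLike hx₀ hT hpb hbp'
    (D.hpb₁.trans D.hb) D.hb₂p' D.hreg D.inter₂

/-- `p₂` is an interior point of `W` (`0 < b₂ < 1`). [cite: MilnorHCobordism1965, Def. 3.1 with Def. 1.1] -/
theorem isInteriorPoint_p₂ : (𝓡∂ (n + 1)).IsInteriorPoint D.p₂ :=
  D.isMorseFunction.isInteriorPoint_of_apply_mem_Ioo
    ⟨by rw [D.f_p₂]; linarith [D.slab.pos, D.δ_pos, D.hb], by rw [D.f_p₂]; linarith [D.slab.lt_one, D.δ_pos]⟩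

/-! ### Left inverses of the derivatives at `0` -/

/-- `domH` is a neighbourhood of `0`. [folklore] -/
theorem domH_mem_nhds : D.domH ∈ 𝓝 (0 : 𝔼 (n - k) × 𝔼 k) := D.isOpen_domH.mem_nhds D.zero_mem_domH

/-- `domΛ'` is a neighbourhood of `0`. [folklore] -/
theorem domΛ'_mem_nhds : D.domΛ' ∈ 𝓝 (0 : 𝔼 (n - k) × 𝔼 k) := D.isOpen_domΛ'.mem_nhds D.zero_mem_domΛ'

/-- **`D(Φinv)(0) ∘ D(Φ)(0) = id`.** [cite: MilnorHCobordism1965, proof of Thm. 5.4, Assertion 6 (PDF pp. 31–32)] -/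
theorem fderiv_Φinv_comp_fderiv_Φ :
    (fderiv ℝ D.Φinv 0).comp (fderiv ℝ D.Φ 0) = ContinuousLinearMap.id ℝ _ := by
  have h := fderiv_comp_fderiv_eq_id_of_eventuallyEq
    ((D.contDiffAt_Φ D.zero_mem_domΦ).differentiableAt (by simp))
    (by rw [D.Φ_zero]; exact (D.contDiffAt_Φinv D.zero_mem_domΦ').differentiableAt (by simp))
    D.eventually_Φinv_Φ
  rwa [D.Φ_zero] at h

/-- **`D(Φ)(0) ∘ D(Φinv)(0) = id`.** [cite: MilnorHCobordism1965, proof of Thm. 5.4, Assertion 6 (PDF pp. 31–32)] -/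
theorem fderiv_Φ_comp_fderiv_Φinv :
    (fderiv ℝ D.Φ 0).comp (fderiv ℝ D.Φinv 0) = ContinuousLinearMap.id ℝ _ := by
  have h := fderiv_comp_fderiv_eq_id_of_eventuallyEq
    ((D.contDiffAt_Φinv D.zero_mem_domΦ').differentiableAt (by simp))
    (by rw [D.Φinv_zero]; exact (D.contDiffAt_Φ D.zero_mem_domΦ).differentiableAt (by simp))
    D.eventually_Φ_Φinv
  rwa [D.Φinv_zero] at h

/-- `D(Hcinv)(0) ∘ D(Hc)(0) = id`. [cite: MilnorHCobordism1965, proof of Thm. 5.4, Assertion 6 (PDF p. 31)] -/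
theorem fderiv_Hcinv_comp_fderiv_Hc :
    (fderiv ℝ D.Hcinv 0).comp (fderiv ℝ D.Hc 0) = ContinuousLinearMap.id ℝ _ := by
  have h := fderiv_comp_fderiv_eq_id_of_eventuallyEq
    ((D.contDiffAt_Hc D.zero_mem_domH).differentiableAt (by simp))
    (by rw [D.Hc_zero]; exact (D.contDiffAt_Hcinv D.zero_mem_domH').differentiableAt (by simp))
    (Filter.mem_of_superset D.domH_mem_nhds fun _ hy => D.Hcinv_Hc hy)
  rwa [D.Hc_zero] at h

/-- `D(Λc)(0) ∘ D(Λcinv)(0) = id`. [cite: MilnorHCobordism1965, proof of Thm. 5.4, Assertion 6 (PDF p. 31)] -/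
theorem fderiv_Λc_comp_fderiv_Λcinv :
    (fderiv ℝ D.Λc 0).comp (fderiv ℝ D.Λcinv 0) = ContinuousLinearMap.id ℝ _ := by
  have h := fderiv_comp_fderiv_eq_id_of_eventuallyEq
    ((D.contDiffAt_Λcinv D.zero_mem_domΛ').differentiableAt (by simp))
    (by rw [D.Λcinv_zero]; exact (D.contDiffAt_Λc D.zero_mem_domΛ).differentiableAt (by simp))
    (Filter.mem_of_superset D.domΛ'_mem_nhds fun _ hy => D.Λc_Λcinv hy)
  rwa [D.Λcinv_zero] at h

/-- **`D(Φ)(0)` is injective.** [cite: MilnorHCobordism1965, proof of Thm. 5.4, Assertion 6 (PDF pp. 31–32)] -/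
theorem injective_fderiv_Φ : Injective (fderiv ℝ D.Φ 0) := by
  intro y₁ y₂ h
  have := congrArg (fderiv ℝ D.Φinv 0) h
  simpa only [← ContinuousLinearMap.comp_apply, D.fderiv_Φinv_comp_fderiv_Φ,
    ContinuousLinearMap.id_apply] using this

/-- `D(Hc)(0)` is injective. [cite: MilnorHCobordism1965, proof of Thm. 5.4, Assertion 6 (PDF p. 31)] -/
theorem injective_fderiv_Hc : Injective (fderiv ℝ D.Hc 0) := by
  intro y₁ y₂ h
  have := congrArg (fderiv ℝ D.Hcinv 0) h
  simpa only [← ContinuousLinearMap.comp_apply, D.fderiv_Hcinv_comp_fderiv_Hc,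
    ContinuousLinearMap.id_apply] using this

/-- `D(Λcinv)(0)` is injective. [cite: MilnorHCobordism1965, proof of Thm. 5.4, Assertion 6 (PDF p. 31)] -/
theorem injective_fderiv_Λcinv : Injective (fderiv ℝ D.Λcinv 0) := by
  intro y₁ y₂ h
  have := congrArg (fderiv ℝ D.Λc 0) h
  simpa only [← ContinuousLinearMap.comp_apply, D.fderiv_Λc_comp_fderiv_Λcinv,
    ContinuousLinearMap.id_apply] using this

/-- **`det D(Φ)(0) ≠ 0`.** [cite: MilnorHCobordism1965, proof of Thm. 5.4, Assertion 6 (PDF p. 32)] -/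
theorem det_fderiv_Φ_ne_zero :
    LinearMap.det (fderiv ℝ D.Φ 0 : (𝔼 (n - k) × 𝔼 k) →ₗ[ℝ] (𝔼 (n - k) × 𝔼 k)) ≠ 0 := by
  intro h0
  have h1 : (fderiv ℝ D.Φinv 0 : (𝔼 (n - k) × 𝔼 k) →ₗ[ℝ] (𝔼 (n - k) × 𝔼 k)).comp
      (fderiv ℝ D.Φ 0 : (𝔼 (n - k) × 𝔼 k) →ₗ[ℝ] (𝔼 (n - k) × 𝔼 k)) = LinearMap.id :=
    congrArg (fun L : (𝔼 (n - k) × 𝔼 k) →L[ℝ] (𝔼 (n - k) × 𝔼 k) =>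
      (L : (𝔼 (n - k) × 𝔼 k) →ₗ[ℝ] (𝔼 (n - k) × 𝔼 k))) D.fderiv_Φinv_comp_fderiv_Φ
  have h2 := congrArg LinearMap.det h1
  rw [LinearMap.det_comp, LinearMap.det_id, h0, mul_zero] at h2
  exact zero_ne_one h2

/-- The chain rule `D(Φ)(0) = D(Λcinv)(0) ∘ D(Hc)(0)`. [folklore] -/
theorem fderiv_Φ_eq : fderiv ℝ D.Φ 0 = (fderiv ℝ D.Λcinv 0).comp (fderiv ℝ D.Hc 0) := by
  have h : HasFDerivAt D.Φ ((fderiv ℝ D.Λcinv (D.Hc 0)).comp (fderiv ℝ D.Hc 0)) 0 :=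
    ((D.contDiffAt_Λcinv (D.Hc_zero ▸ D.zero_mem_domΛ' :)).differentiableAt (by simp)).hasFDerivAt.comp 0
      ((D.contDiffAt_Hc D.zero_mem_domH).differentiableAt (by simp)).hasFDerivAt
  rw [h.fderiv, D.Hc_zero]

/-! ### `D(Λcinv)(0)` is block-diagonal -/

/-- **`pr_a D(Λcinv)(0)(0, w) = 0`**: `h'⁻¹` preserves the plane `Rᵇ`. [cite: MilnorHCobordism1965, proof of Thm. 5.4, Assertion 6 (PDF p. 31)] -/
theorem fst_fderiv_Λcinv_inr (w : 𝔼 k) : (fderiv ℝ D.Λcinv 0 ((0 : 𝔼 (n - k)), w)).1 = 0 := by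
  -- `g w = pr_a (Λcinv (0, w))` vanishes near `0`
  set g : 𝔼 k → 𝔼 (n - k) := fun w => (D.Λcinv (0, w)).1 with hg
  have hev : ∀ᶠ w in 𝓝 (0 : 𝔼 k), g w = 0 := by
    have hcont : ContinuousAt (fun w : 𝔼 k => ((0 : 𝔼 (n - k)), w)) 0 :=
      (continuous_const.prodMk continuous_id).continuousAt
    have hmem : ∀ᶠ w in 𝓝 (0 : 𝔼 k), ((0 : 𝔼 (n - k)), w) ∈ D.domΛ' :=
      hcont.preimage_mem_nhds D.domΛ'_mem_nhds
    exact hmem.mono fun w hw => D.Λcinv_fst_eq_zero hw rfl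
  have hg0 : HasFDerivAt g (0 : 𝔼 k →L[ℝ] 𝔼 (n - k)) 0 :=
    (hasFDerivAt_const (0 : 𝔼 (n - k)) (0 : 𝔼 k)).congr_of_eventuallyEq (hev.mono fun w hw => hw)
  -- chain rule
  have hd : DifferentiableAt ℝ D.Λcinv ((0 : 𝔼 (n - k)), (0 : 𝔼 k)) :=
    (D.contDiffAt_Λcinv D.zero_mem_domΛ').differentiableAt (by simp)
  have hinner : HasFDerivAt (fun w : 𝔼 k => D.Λcinv ((0 : 𝔼 (n - k)), w))
      ((fderiv ℝ D.Λcinv ((0 : 𝔼 (n - k)), (0 : 𝔼 k))).comp (ContinuousLinearMap.inr ℝ (𝔼 (n - k)) (𝔼 k))) 0 :=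
    hd.hasFDerivAt.comp (f := fun w : 𝔼 k => ((0 : 𝔼 (n - k)), w)) 0
      (hasFDerivAt_prodMk_right (0 : 𝔼 (n - k)) (0 : 𝔼 k))
  have h1 : HasFDerivAt g ((ContinuousLinearMap.fst ℝ (𝔼 (n - k)) (𝔼 k)).comp
      ((fderiv ℝ D.Λcinv ((0 : 𝔼 (n - k)), (0 : 𝔼 k))).comp
        (ContinuousLinearMap.inr ℝ (𝔼 (n - k)) (𝔼 k)))) 0 :=
    (ContinuousLinearMap.fst ℝ (𝔼 (n - k)) (𝔼 k)).hasFDerivAt.comp 0 hinner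
  have h2 := h1.unique hg0
  have h3 := congrArg (fun L : 𝔼 k →L[ℝ] 𝔼 (n - k) => L w) h2
  simp only [zero_apply, ContinuousLinearMap.comp_apply,
    ContinuousLinearMap.inr_apply, ContinuousLinearMap.coe_fst'] at h3
  exact h3

/-- `pr_b D(Λcinv)(0)(u, 0) = 0`: `h'⁻¹` preserves the plane `Rᵃ`. [cite: MilnorHCobordism1965, proof of Thm. 5.4, Assertion 6 (PDF p. 31)] -/
theorem snd_fderiv_Λcinv_inl (u : 𝔼 (n - k)) : (fderiv ℝ D.Λcinv 0 (u, (0 : 𝔼 k))).2 = 0 := by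
  set g : 𝔼 (n - k) → 𝔼 k := fun u => (D.Λcinv (u, 0)).2 with hg
  have hev : ∀ᶠ u in 𝓝 (0 : 𝔼 (n - k)), g u = 0 := by
    have hcont : ContinuousAt (fun u : 𝔼 (n - k) => (u, (0 : 𝔼 k))) 0 :=
      (continuous_id.prodMk continuous_const).continuousAt
    have hmem : ∀ᶠ u in 𝓝 (0 : 𝔼 (n - k)), (u, (0 : 𝔼 k)) ∈ D.domΛ' :=
      hcont.preimage_mem_nhds D.domΛ'_mem_nhds
    exact hmem.mono fun u hu => D.Λcinv_snd_eq_zero hu rfl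
  have hg0 : HasFDerivAt g (0 : 𝔼 (n - k) →L[ℝ] 𝔼 k) 0 :=
    (hasFDerivAt_const (0 : 𝔼 k) (0 : 𝔼 (n - k))).congr_of_eventuallyEq (hev.mono fun u hu => hu)
  have hd : DifferentiableAt ℝ D.Λcinv ((0 : 𝔼 (n - k)), (0 : 𝔼 k)) :=
    (D.contDiffAt_Λcinv D.zero_mem_domΛ').differentiableAt (by simp)
  have hinner : HasFDerivAt (fun u : 𝔼 (n - k) => D.Λcinv (u, (0 : 𝔼 k)))
      ((fderiv ℝ D.Λcinv ((0 : 𝔼 (n - k)), (0 : 𝔼 k))).comp (ContinuousLinearMap.inl ℝ (𝔼 (n - k)) (𝔼 k))) 0 :=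
    hd.hasFDerivAt.comp (f := fun u : 𝔼 (n - k) => (u, (0 : 𝔼 k))) 0
      (hasFDerivAt_prodMk_left (0 : 𝔼 (n - k)) (0 : 𝔼 k))
  have h1 : HasFDerivAt g ((ContinuousLinearMap.snd ℝ (𝔼 (n - k)) (𝔼 k)).comp
      ((fderiv ℝ D.Λcinv ((0 : 𝔼 (n - k)), (0 : 𝔼 k))).comp
        (ContinuousLinearMap.inl ℝ (𝔼 (n - k)) (𝔼 k)))) 0 :=
    (ContinuousLinearMap.snd ℝ (𝔼 (n - k)) (𝔼 k)).hasFDerivAt.comp 0 hinner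
  have h2 := h1.unique hg0
  have h3 := congrArg (fun L : 𝔼 (n - k) →L[ℝ] 𝔼 k => L u) h2
  simp only [zero_apply, ContinuousLinearMap.comp_apply,
    ContinuousLinearMap.inl_apply, ContinuousLinearMap.coe_snd'] at h3
  exact h3

/-- **The block `A` of `D(Λcinv)(0)` is injective.** [cite: MilnorHCobordism1965, proof of Thm. 5.4, Assertion 6 (PDF p. 31)] -/
theorem injective_fstBlock_fderiv_Λcinv : Injective (fstBlock (fderiv ℝ D.Λcinv 0)) := by
  intro u₁ u₂ h
  simp only [fstBlock_apply] at h
  have h1 : fderiv ℝ D.Λcinv 0 (u₁, 0) = fderiv ℝ D.Λcinv 0 (u₂, 0) :=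
    Prod.ext h (by rw [D.snd_fderiv_Λcinv_inl, D.snd_fderiv_Λcinv_inl])
  exact (Prod.mk.inj (D.injective_fderiv_Λcinv h1)).1

/-- `pr_a D(Λcinv)(0) ζ = A (pr_a ζ)` with `A = fstBlock D(Λcinv)(0)` (block-diagonal form). [cite: MilnorHCobordism1965, proof of Thm. 5.4, Assertion 6 (PDF p. 31)] -/
theorem fst_fderiv_Λcinv (ζ : 𝔼 (n - k) × 𝔼 k) :
    (fderiv ℝ D.Λcinv 0 ζ).1 = fstBlock (fderiv ℝ D.Λcinv 0) ζ.1 := by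
  have hζ : ζ = (ζ.1, (0 : 𝔼 k)) + ((0 : 𝔼 (n - k)), ζ.2) := by simp
  conv_lhs => rw [hζ, map_add]
  rw [Prod.fst_add, D.fst_fderiv_Λcinv_inr, add_zero, fstBlock_apply]

/-! ### The block `A` of `D(h₀⁻¹h)(0)` is invertible -/

/-- **The block `A` of `D(Φ)(0)`, `Φ = h₀⁻¹h` in the level coordinates at `p₁`, is injective**
(hence invertible): transversality of `S_R(b₂)` and `S_L'(b₂)` at `p₂`.
[cite: MilnorHCobordism1965, proof of Thm. 5.4, Assertion 6 (PDF pp. 31–32); proof of Lemma 5.7 (PDF p. 33)] -/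
theorem injective_fstBlock_fderiv_Φ [T2Space M] [T2Space N] [IsManifold (𝓡 n) ∞ M] [IsManifold (𝓡 n) ∞ N]
    (hT : IsTransverseInLevel (𝓡∂ (n + 1)) (f ⁻¹' {b₂}) (rightHandSphere (𝓡∂ (n + 1)) f ξ p b₂)
      (leftHandSphere (𝓡∂ (n + 1)) f ξ p' b₂) D.p₂) :
    Injective (fstBlock (fderiv ℝ D.Φ 0)) := by
  obtain ⟨φ, hφ, hp₂φ, ℓ, S, hℓS, hL, hA, hB⟩ := hT
  -- notation: the straightening chart read in the model, and its composite with `lift₂`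
  set I := (𝓡∂ (n + 1)) with hI
  set Θ : 𝔼 (n - k) × 𝔼 k → 𝔼 (n + 1) := fun y => φ.extend I (D.lift₂ y) with hΘ
  set Ξ : 𝔼 (n + 1) → 𝔼 (n - k) × 𝔼 k := fun x => D.ψ₂ (φ.symm (I.symm x)) with hΞ
  set cpt : 𝔼 (n + 1) := φ.extend I D.p₂ with hcpt
  have hΘ0 : Θ 0 = cpt := by
    show φ.extend I (D.lift₂ 0) = φ.extend I D.p₂
    rw [D.lift₂_zero]
  -- smoothness of `Θ` at `0` and of `Ξ` at `cpt`
  have hφs : ContMDiffAt I I ∞ φ D.p₂ :=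
    (contMDiffOn_of_mem_maximalAtlas hφ).contMDiffAt (φ.open_source.mem_nhds hp₂φ)
  have hΘs : ContDiffAt ℝ ∞ Θ 0 := by
    refine contMDiffAt_iff_contDiffAt.1 ?_
    have h1 : ContMDiffAt 𝓘(ℝ, 𝔼 (n - k) × 𝔼 k) I ∞ D.lift₂ 0 := D.contMDiffAt_lift₂ D.zero_mem_dom₂
    have h2 : ContMDiffAt I 𝓘(ℝ, 𝔼 (n + 1)) ∞ (fun z => φ.extend I z) (D.lift₂ 0) := by
      rw [D.lift₂_zero]
      simpa only [OpenPartialHomeomorph.extend_coe] using I.contMDiff.contMDiffAt.comp D.p₂ hφs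
    have hΘeq : Θ = (fun z => φ.extend I z) ∘ D.lift₂ := rfl
    rw [hΘeq]
    exact h2.comp 0 h1
  have hrange : range I ∈ 𝓝 cpt :=
    range_mem_nhds_extend_of_isInteriorPoint (n := ∞) (by simp) hφ hp₂φ D.isInteriorPoint_p₂
  have hΞs : ContDiffAt ℝ ∞ Ξ cpt := by
    refine contMDiffAt_iff_contDiffAt.1 ?_
    have h1 : ContMDiffAt 𝓘(ℝ, 𝔼 (n + 1)) I ∞ I.symm cpt := I.contMDiffOn_symm.contMDiffAt hrange
    have h2 : ContMDiffAt I I ∞ φ.symm (I.symm cpt) := by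
      have : I.symm cpt = φ D.p₂ := by simp [hcpt]
      rw [this]
      exact (contMDiffOn_symm_of_mem_maximalAtlas hφ).contMDiffAt
        (φ.open_target.mem_nhds (φ.map_source hp₂φ))
    have h3 : ContMDiffAt I 𝓘(ℝ, 𝔼 (n - k) × 𝔼 k) ∞ D.ψ₂ (φ.symm (I.symm cpt)) := by
      have : φ.symm (I.symm cpt) = D.p₂ := by simp [hcpt, φ.left_inv hp₂φ]
      rw [this]
      exact D.contMDiffAt_ψ₂ D.p₂_mem
    have hΞeq : Ξ = D.ψ₂ ∘ (φ.symm ∘ I.symm) := rfl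
    rw [hΞeq]
    exact h3.comp cpt (h2.comp cpt h1)
  -- `Ξ ∘ Θ = id` near `0`, so `D(Θ)(0)` is injective
  have hlift₂φ : ∀ᶠ y in 𝓝 (0 : 𝔼 (n - k) × 𝔼 k), y ∈ D.dom₂ ∧ D.lift₂ y ∈ φ.source := by
    have h1 : ∀ᶠ y in 𝓝 (0 : 𝔼 (n - k) × 𝔼 k), y ∈ D.dom₂ := D.isOpen_dom₂.mem_nhds D.zero_mem_dom₂
    have h2 : ∀ᶠ y in 𝓝 (0 : 𝔼 (n - k) × 𝔼 k), D.lift₂ y ∈ φ.source :=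
      (D.contMDiffAt_lift₂ D.zero_mem_dom₂).continuousAt.preimage_mem_nhds
        (φ.open_source.mem_nhds (by rw [D.lift₂_zero]; exact hp₂φ))
    exact h1.and h2
  have hΞΘ : ∀ᶠ y in 𝓝 (0 : 𝔼 (n - k) × 𝔼 k), Ξ (Θ y) = y := by
    refine hlift₂φ.mono fun y hy => ?_
    simp only [hΞ, hΘ, OpenPartialHomeomorph.extend_coe, comp_apply, I.left_inv, φ.left_inv hy.2]
    exact D.ψ₂_lift₂ hy.1
  have hΘinj : Injective (fderiv ℝ Θ 0) := by
    have h := fderiv_comp_fderiv_eq_id_of_eventuallyEq (hΘs.differentiableAt (by simp))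
      (by rw [hΘ0]; exact hΞs.differentiableAt (by simp)) hΞΘ
    intro y₁ y₂ hy
    have := congrArg (fderiv ℝ Ξ (Θ 0)) hy
    simpa only [← ContinuousLinearMap.comp_apply, h, ContinuousLinearMap.id_apply] using this
  -- (**) the coordinates `i ∈ S ∪ {ℓ}` of `Θ(0, w)` are constant near `w = 0`
  have hBev : ∀ᶠ w in 𝓝 (0 : 𝔼 k), ∀ i, i = ℓ ∨ i ∈ S → Θ (0, w) i = cpt i := by
    have hcont : ContinuousAt (fun w : 𝔼 k => ((0 : 𝔼 (n - k)), w)) 0 :=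
      (continuous_const.prodMk continuous_id).continuousAt
    have hmem : ∀ᶠ w in 𝓝 (0 : 𝔼 k), ((0 : 𝔼 (n - k)), w) ∈ {y | y ∈ D.dom₂ ∧ D.lift₂ y ∈ φ.source} :=
      hcont.preimage_mem_nhds hlift₂φ
    refine hmem.mono fun w hw i hi => ?_
    have hwL : D.lift₂ (0, w) ∈ leftHandSphere (𝓡∂ (n + 1)) f ξ p' b₂ := by
      refine D.mem_leftHandSphere_of_ψ₂ (D.lift₂_mem hw.1) (D.f_lift₂ hw.1) ?_
      rw [D.ψ₂_lift₂ hw.1]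
    exact ((hB _ hw.2).1 hwL) i hi
  -- (*) the coordinates `i ∉ S` of `Θ(Hc(u, 0))` are constant near `u = 0`
  have hAev : ∀ᶠ u in 𝓝 (0 : 𝔼 (n - k)), ∀ i, i ∉ S → Θ (D.Hc (u, 0)) i = cpt i := by
    have hcont : ContinuousAt (fun u : 𝔼 (n - k) => (u, (0 : 𝔼 k))) 0 :=
      (continuous_id.prodMk continuous_const).continuousAt
    have hHc : ContinuousAt D.Hc 0 := (D.contDiffAt_Hc D.zero_mem_domH).continuousAt
    have hdomH : ∀ᶠ y in 𝓝 (0 : 𝔼 (n - k) × 𝔼 k), y ∈ D.domH := D.domH_mem_nhds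
    have hHc' : ∀ᶠ y in 𝓝 (0 : 𝔼 (n - k) × 𝔼 k), D.Hc y ∈ {y | y ∈ D.dom₂ ∧ D.lift₂ y ∈ φ.source} :=
      hHc.preimage_mem_nhds (by rw [D.Hc_zero]; exact hlift₂φ)
    have hpre : ∀ᶠ y in 𝓝 (0 : 𝔼 (n - k) × 𝔼 k), y ∈ D.domH ∧ D.Hc y ∈ {y | y ∈ D.dom₂ ∧ D.lift₂ y ∈ φ.source} :=
      hdomH.and hHc'
    have hmem : ∀ᶠ u in 𝓝 (0 : 𝔼 (n - k)), (u, (0 : 𝔼 k)) ∈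
        {y | y ∈ D.domH ∧ D.Hc y ∈ {y | y ∈ D.dom₂ ∧ D.lift₂ y ∈ φ.source}} :=
      hcont.preimage_mem_nhds hpre
    refine hmem.mono fun u hu i hi => ?_
    have huR : D.lift₂ (D.Hc (u, 0)) ∈ rightHandSphere (𝓡∂ (n + 1)) f ξ p b₂ :=
      D.lift₂_Hc_mem_rightHandSphere hu.1
    exact ((hA _ hu.2.2).1 huR) i hi
  -- differentiate (**) and (*)
  have hΘd : DifferentiableAt ℝ Θ ((0 : 𝔼 (n - k)), (0 : 𝔼 k)) := hΘs.differentiableAt (by simp)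
  have hBder : ∀ w : 𝔼 k, ∀ i, i = ℓ ∨ i ∈ S → fderiv ℝ Θ 0 ((0 : 𝔼 (n - k)), w) i = 0 := by
    intro w i hi
    set g : 𝔼 k → ℝ := fun w => EuclideanSpace.proj (𝕜 := ℝ) i (Θ (0, w)) with hg
    have hg0 : HasFDerivAt g (0 : 𝔼 k →L[ℝ] ℝ) 0 :=
      (hasFDerivAt_const (cpt i) (0 : 𝔼 k)).congr_of_eventuallyEq (hBev.mono fun w hw => hw i hi)
    have hinner : HasFDerivAt (fun w : 𝔼 k => Θ ((0 : 𝔼 (n - k)), w))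
        ((fderiv ℝ Θ ((0 : 𝔼 (n - k)), (0 : 𝔼 k))).comp (ContinuousLinearMap.inr ℝ (𝔼 (n - k)) (𝔼 k))) 0 :=
      hΘd.hasFDerivAt.comp (f := fun w : 𝔼 k => ((0 : 𝔼 (n - k)), w)) 0
        (hasFDerivAt_prodMk_right (0 : 𝔼 (n - k)) (0 : 𝔼 k))
    have h1 : HasFDerivAt g ((EuclideanSpace.proj (𝕜 := ℝ) i : 𝔼 (n + 1) →L[ℝ] ℝ).comp
        ((fderiv ℝ Θ ((0 : 𝔼 (n - k)), (0 : 𝔼 k))).comp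
          (ContinuousLinearMap.inr ℝ (𝔼 (n - k)) (𝔼 k)))) 0 :=
      (EuclideanSpace.proj (𝕜 := ℝ) i : 𝔼 (n + 1) →L[ℝ] ℝ).hasFDerivAt.comp 0 hinner
    have h2 := h1.unique hg0
    have h3 := congrArg (fun L : 𝔼 k →L[ℝ] ℝ => L w) h2
    simp only [zero_apply, ContinuousLinearMap.comp_apply,
      ContinuousLinearMap.inr_apply, PiLp.proj_apply] at h3
    exact h3
  have hHcd : DifferentiableAt ℝ D.Hc ((0 : 𝔼 (n - k)), (0 : 𝔼 k)) :=
    (D.contDiffAt_Hc D.zero_mem_domH).differentiableAt (by simp)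
  have hAder : ∀ u : 𝔼 (n - k), ∀ i, i ∉ S →
      fderiv ℝ Θ 0 (fderiv ℝ D.Hc 0 (u, (0 : 𝔼 k))) i = 0 := by
    intro u i hi
    set g : 𝔼 (n - k) → ℝ := fun u => EuclideanSpace.proj (𝕜 := ℝ) i (Θ (D.Hc (u, 0))) with hg
    have hg0 : HasFDerivAt g (0 : 𝔼 (n - k) →L[ℝ] ℝ) 0 :=
      (hasFDerivAt_const (cpt i) (0 : 𝔼 (n - k))).congr_of_eventuallyEq (hAev.mono fun u hu => hu i hi)
    have hΘd' : DifferentiableAt ℝ Θ (D.Hc ((0 : 𝔼 (n - k)), (0 : 𝔼 k))) := by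
      rw [show ((0 : 𝔼 (n - k)), (0 : 𝔼 k)) = (0 : 𝔼 (n - k) × 𝔼 k) from rfl, D.Hc_zero]
      exact hΘs.differentiableAt (by simp)
    have hinner₁ : HasFDerivAt (fun u : 𝔼 (n - k) => D.Hc (u, (0 : 𝔼 k)))
        ((fderiv ℝ D.Hc ((0 : 𝔼 (n - k)), (0 : 𝔼 k))).comp (ContinuousLinearMap.inl ℝ (𝔼 (n - k)) (𝔼 k))) 0 :=
      hHcd.hasFDerivAt.comp (f := fun u : 𝔼 (n - k) => (u, (0 : 𝔼 k))) 0
        (hasFDerivAt_prodMk_left (0 : 𝔼 (n - k)) (0 : 𝔼 k))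
    have hinner₂ : HasFDerivAt (fun u : 𝔼 (n - k) => Θ (D.Hc (u, (0 : 𝔼 k))))
        ((fderiv ℝ Θ (D.Hc ((0 : 𝔼 (n - k)), (0 : 𝔼 k)))).comp
          ((fderiv ℝ D.Hc ((0 : 𝔼 (n - k)), (0 : 𝔼 k))).comp (ContinuousLinearMap.inl ℝ (𝔼 (n - k)) (𝔼 k)))) 0 :=
      hΘd'.hasFDerivAt.comp (f := fun u : 𝔼 (n - k) => D.Hc (u, (0 : 𝔼 k))) 0 hinner₁
    have h1 : HasFDerivAt g ((EuclideanSpace.proj (𝕜 := ℝ) i : 𝔼 (n + 1) →L[ℝ] ℝ).comp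
        ((fderiv ℝ Θ (D.Hc ((0 : 𝔼 (n - k)), (0 : 𝔼 k)))).comp
          ((fderiv ℝ D.Hc ((0 : 𝔼 (n - k)), (0 : 𝔼 k))).comp
            (ContinuousLinearMap.inl ℝ (𝔼 (n - k)) (𝔼 k))))) 0 :=
      (EuclideanSpace.proj (𝕜 := ℝ) i : 𝔼 (n + 1) →L[ℝ] ℝ).hasFDerivAt.comp 0 hinner₂
    have h2 := h1.unique hg0
    have h3 := congrArg (fun L : 𝔼 (n - k) →L[ℝ] ℝ => L u) h2
    simp only [zero_apply, ContinuousLinearMap.comp_apply,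
      ContinuousLinearMap.inl_apply, PiLp.proj_apply] at h3
    rw [show ((0 : 𝔼 (n - k)), (0 : 𝔼 k)) = (0 : 𝔼 (n - k) × 𝔼 k) from rfl, D.Hc_zero] at h3
    exact h3
  -- the main computation
  intro u₁ u₂ h12
  rw [← sub_eq_zero] at h12 ⊢
  set u : 𝔼 (n - k) := u₁ - u₂ with hu
  have h0 : fstBlock (fderiv ℝ D.Φ 0) u = 0 := by rw [hu, map_sub, h12]
  -- `ζ = D(Hc)(0)(u, 0)` has `pr_a ζ = 0`
  set ζ : 𝔼 (n - k) × 𝔼 k := fderiv ℝ D.Hc 0 (u, 0) with hζ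
  have hζ1 : ζ.1 = 0 := by
    apply D.injective_fstBlock_fderiv_Λcinv
    rw [map_zero, ← D.fst_fderiv_Λcinv ζ]
    rw [fstBlock_apply, D.fderiv_Φ_eq, ContinuousLinearMap.comp_apply] at h0
    exact h0
  -- hence `D(Θ)(0) ζ = 0`, so `ζ = 0`, so `u = 0`
  have hζeq : ζ = ((0 : 𝔼 (n - k)), ζ.2) := Prod.ext hζ1 rfl
  have hΘζ : fderiv ℝ Θ 0 ζ = 0 := by
    ext i
    rw [PiLp.zero_apply]
    by_cases hi : i = ℓ ∨ i ∈ S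
    · rw [hζeq]
      exact hBder ζ.2 i hi
    · have hi' : i ∉ S := fun h => hi (Or.inr h)
      exact hAder u i hi'
  have hζ0 : ζ = 0 := hΘinj (by rw [hΘζ, map_zero])
  have hu0 : (u, (0 : 𝔼 k)) = (0 : 𝔼 (n - k) × 𝔼 k) := D.injective_fderiv_Hc (by rw [← hζ, hζ0, map_zero])
  exact (Prod.mk.inj hu0).1

/-- **`det A ≠ 0` for the block `A` of `D(h₀⁻¹h)(0)`** (transversality of `h₀⁻¹h(Rᵃ)` and `Rᵇ`
at `0`). [cite: MilnorHCobordism1965, proof of Thm. 5.4, Assertion 6 (PDF pp. 31–32); proof of Lemma 5.7 (PDF p. 33)] -/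
theorem det_fstBlock_fderiv_Φ_ne_zero [T2Space M] [T2Space N] [IsManifold (𝓡 n) ∞ M]
    [IsManifold (𝓡 n) ∞ N]
    (hT : IsTransverseInLevel (𝓡∂ (n + 1)) (f ⁻¹' {b₂}) (rightHandSphere (𝓡∂ (n + 1)) f ξ p b₂)
      (leftHandSphere (𝓡∂ (n + 1)) f ξ p' b₂) D.p₂) :
    LinearMap.det (fstBlock (fderiv ℝ D.Φ 0) : 𝔼 (n - k) →ₗ[ℝ] 𝔼 (n - k)) ≠ 0 := by
  set L : 𝔼 (n - k) →ₗ[ℝ] 𝔼 (n - k) := (fstBlock (fderiv ℝ D.Φ 0) : 𝔼 (n - k) →ₗ[ℝ] 𝔼 (n - k))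
  have hinj : Injective L := D.injective_fstBlock_fderiv_Φ hT
  have hunit : IsUnit L := (LinearMap.isUnit_iff_ker_eq_bot L).2 (LinearMap.ker_eq_bot.2 hinj)
  exact ((LinearMap.isUnit_iff_isUnit_det L).1 hunit).ne_zero

end CancellationFrame

end Cobordism

end Literature.Topology.FourManifolds
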